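import Literature.NumberTheory.EllipticCurves.WeierstrassSchemeCharts
import HarnessLib

/-!
# The transition function between the two charts of the Weierstrass cubic

On the overlap `E_W ∩ D₊(y) ∩ D₊(z)` of the affine chart (coordinates `x = X/Z, y = Y/Z`) and the
chart at infinity (coordinates `u = X/Y, v = Z/Y`) of `E_W = W.scheme`
(`EllipticCurves/WeierstrassSchemeCharts`) one has `u·y = x` and `v·y = 1` (Silverman, *AEC*,
IV.1: `z = −x/y, w = −1/y`, up to sign). We prove this in the form consumed by the theory of
points (`EllipticCurves/WeierstrassSchemePoints`): for any commutative ring `B` and any `B`-point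
of `E_W` lying in both charts, with affine coordinates `α : K[x,y]/(W) → B` and coordinates at
infinity `β : K[u,v]/(W∞) → B`, `β(u)·α(y) = α(x)` and `β(v)·α(y) = 1` (`transition`).

Proof: such a point factors through `D₊(yz) = Spec (K[x]_{yz})₀ ↪ ℙ²` (Mathlib `Proj.awayι`,
`Proj.SpecMap_awayMap_awayι`, `IsOpenImmersion.lift`), the two chart embeddings are `Spec` of the
restriction maps `(K[x]_z)₀ → (K[x]_{yz})₀ ← (K[x]_y)₀` followed by the quotient maps, and in
`(K[x]_{yz})₀` the identities `(xz/yz)(y²/yz) = xy/yz`, `(z²/yz)(y²/yz) = 1` hold.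

## References

* J. H. Silverman, *The Arithmetic of Elliptic Curves*, 2nd ed., GTM 106 (2009): IV.1.
  [SilvermanAEC2009]
* R. Hartshorne, *Algebraic Geometry*, GTM 52 (1977): II Prop. 2.5(b). [Hartshorne1977]
-/

noncomputable section

open MvPolynomial Literature.AlgebraicGeometry.Motives

universe u

namespace Literature.NumberTheory.EllipticCurves

namespace WeierstrassScheme

section Charts

open _root_.AlgebraicGeometry _root_.CategoryTheory HomogeneousLocalization TopologicalSpace

-- Mathlib's `Proj`/`Spec` API is stated up to instance-transparent unfolding (as in Mathlib itself
-- around `Proj.awayι`, `pullback.map`); see `Motives/ProjBasicOpenSubscheme`.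
set_option backward.isDefEq.respectTransparency false

variable {K : Type u} [Field K] (W : WeierstrassCurve K)

attribute [local instance] MvPolynomial.gradedAlgebra ProjBaseChange.algebraBase
  ProjBaseChange.isScalarTower_localization

local notation "𝒜" => MvPolynomial.homogeneousSubmodule (Fin (1 + 2)) K

/-! ### Transition between the two charts -/

/-- The class of `x` in `K[x,y]/(W)`. [folklore] -/
abbrev affX : AffineRing W := Ideal.Quotient.mk _ (X 0)

/-- The class of `y` in `K[x,y]/(W)`. [folklore] -/
abbrev affY : AffineRing W := Ideal.Quotient.mk _ (X 1)

/-- The ring map `(K[x]_{xᵢ})₀ → K[y₀,y₁]/(F(xᵢ:=1))` along which the chart over `D₊(xᵢ)` embeds: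
`awayToSection`, the quotient map, and `chartRingEquiv`. [folklore] -/
def chartHom (i : Fin 3) (hp : Prime (chartPolynomial W i)) :
    Away 𝒜 (X i) →+* (MvPolynomial (Fin 2) K ⧸ Ideal.span {chartPolynomial W i}) :=
  (chartRingEquiv W i hp).toRingHom.comp ((Ideal.Quotient.mk _).comp (Proj.awayToSection 𝒜 (X i)).hom)

/-- `chartHom` is the chart isomorphism followed by the quotient map. [folklore] -/
theorem chartHom_apply (i : Fin 3) (hp : Prime (chartPolynomial W i)) (a : Away 𝒜 (X i)) :
    chartHom W i hp a = Ideal.Quotient.mk _ (ProjectiveSpace.chartAlgEquiv K i a) := by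
  change chartRingEquiv W i hp (Ideal.Quotient.mk _ ((Proj.awayToSection 𝒜 (X i)).hom a)) = _
  rw [chartRingEquiv, Ideal.quotientEquiv_mk, sectionsEquiv_awayToSection]

/-- `chartHom` sends the generator `x_{i.succAbove j}/xᵢ` to the class of `yⱼ`. [folklore] -/
theorem chartHom_chartGen (i : Fin 3) (hp : Prime (chartPolynomial W i)) (j : Fin 2) :
    chartHom W i hp (ProjectiveSpace.chartGen K i j) = Ideal.Quotient.mk _ (X j) := by
  rw [chartHom_apply, ← ProjectiveSpace.chartAlgEquiv_symm_X, AlgEquiv.apply_symm_apply]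

/-- `chart_curveEmb` with the ring map packaged as `chartHom`. [folklore] -/
theorem chart_curveEmb' (i : Fin 3) (hp : Prime (chartPolynomial W i)) :
    chart W i hp ≫ curveEmb W =
      Spec.map (CommRingCat.ofHom (chartHom W i hp)) ≫
        Proj.awayι 𝒜 (X i) (ProjectiveSpace.X_mem i) one_pos :=
  chart_curveEmb W i hp

/-- `yz` is homogeneous of degree `2`. [folklore] -/
theorem X_one_mul_X_two_mem :
    (X 1 * X 2 : MvPolynomial (Fin (1 + 2)) K) ∈ MvPolynomial.homogeneousSubmodule (Fin (1 + 2)) K 2 :=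
  SetLike.mul_mem_graded (ProjectiveSpace.X_mem 1) (ProjectiveSpace.X_mem 2)

/-- `D₊(yz) ↪ ℙ²`. [folklore] -/
abbrev awayιYZ : Spec (CommRingCat.of (Away 𝒜 (X 1 * X 2 : MvPolynomial (Fin (1 + 2)) K))) ⟶ Proj 𝒜 :=
  Proj.awayι 𝒜 (X 1 * X 2) X_one_mul_X_two_mem two_pos

/-- Restriction `(K[x]_{z})₀ → (K[x]_{yz})₀`. [folklore] -/
abbrev resZ : Away 𝒜 (X 2 : MvPolynomial (Fin (1 + 2)) K) →+* Away 𝒜 (X 1 * X 2 : MvPolynomial (Fin (1 + 2)) K) :=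
  awayMap 𝒜 (ProjectiveSpace.X_mem 1) (mul_comm (X 1) (X 2))

/-- Restriction `(K[x]_{y})₀ → (K[x]_{yz})₀`. [folklore] -/
abbrev resY : Away 𝒜 (X 1 : MvPolynomial (Fin (1 + 2)) K) →+* Away 𝒜 (X 1 * X 2 : MvPolynomial (Fin (1 + 2)) K) :=
  awayMap 𝒜 (ProjectiveSpace.X_mem 2) rfl

/-- `D₊(yz) ↪ ℙ²` factors through `D₊(z)` by `Spec` of the restriction map (Mathlib `Proj.SpecMap_awayMap_awayι`). [folklore] -/
theorem specMap_resZ_awayι :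
    Spec.map (CommRingCat.ofHom (resZ (K := K))) ≫ Proj.awayι 𝒜 (X 2) (ProjectiveSpace.X_mem 2) one_pos =
      awayιYZ :=
  Proj.SpecMap_awayMap_awayι 𝒜 (ProjectiveSpace.X_mem 2) one_pos (ProjectiveSpace.X_mem 1) _

/-- `D₊(yz) ↪ ℙ²` factors through `D₊(y)` by `Spec` of the restriction map (Mathlib `Proj.SpecMap_awayMap_awayι`). [folklore] -/
theorem specMap_resY_awayι :
    Spec.map (CommRingCat.ofHom (resY (K := K))) ≫ Proj.awayι 𝒜 (X 1) (ProjectiveSpace.X_mem 1) one_pos =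
      awayιYZ :=
  Proj.SpecMap_awayMap_awayι 𝒜 (ProjectiveSpace.X_mem 1) one_pos (ProjectiveSpace.X_mem 2) _

/-- The element `a/(yz)` of `(K[x]_{yz})₀` for `a` homogeneous of degree `2`. [folklore] -/
abbrev fracYZ (a : MvPolynomial (Fin (1 + 2)) K)
    (ha : a ∈ MvPolynomial.homogeneousSubmodule (Fin (1 + 2)) K (1 • 2)) :
    Away 𝒜 (X 1 * X 2 : MvPolynomial (Fin (1 + 2)) K) :=
  HomogeneousLocalization.Away.mk 𝒜 X_one_mul_X_two_mem 1 a ha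

/-- `xᵢxⱼ` is homogeneous of degree `2`. [folklore] -/
theorem mul_mem_two (i j : Fin (1 + 2)) :
    (X i * X j : MvPolynomial (Fin (1 + 2)) K) ∈ MvPolynomial.homogeneousSubmodule (Fin (1 + 2)) K (1 • 2) :=
  SetLike.mul_mem_graded (ProjectiveSpace.X_mem i) (ProjectiveSpace.X_mem j)

/-- Restriction of the generator `xⱼ/z` of `(K[x]_{z})₀` to `D₊(yz)` is `xⱼy/(yz)`. [folklore] -/
theorem resZ_chartGen (j : Fin 2) :
    resZ (ProjectiveSpace.chartGen K 2 j) = fracYZ (X ((2 : Fin 3).succAbove j) * X 1) (mul_mem_two _ _) := by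
  rw [ProjectiveSpace.chartGen, awayMap_mk]
  simp only [pow_one]

/-- Restriction of the generator `xⱼ/y` of `(K[x]_{y})₀` to `D₊(yz)` is `xⱼz/(yz)`. [folklore] -/
theorem resY_chartGen (j : Fin 2) :
    resY (ProjectiveSpace.chartGen K 1 j) = fracYZ (X ((1 : Fin 3).succAbove j) * X 2) (mul_mem_two _ _) := by
  rw [ProjectiveSpace.chartGen, awayMap_mk]
  simp only [pow_one]

/-- `(a/(yz)) · (b/(yz)) = (c/(yz))·1` whenever `a b = c · yz`. [folklore] -/
theorem fracYZ_mul_fracYZ {a b c : MvPolynomial (Fin (1 + 2)) K} (ha hb hc)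
    (h : a * b = c * (X 1 * X 2)) : fracYZ a ha * fracYZ b hb = fracYZ c hc := by
  refine HomogeneousLocalization.val_injective _ ?_
  rw [HomogeneousLocalization.val_mul]
  simp only [HomogeneousLocalization.Away.val_mk, Localization.mk_mul, pow_one]
  rw [Localization.mk_eq_mk_iff, Localization.r_iff_exists]
  refine ⟨1, ?_⟩
  simp only [OneMemClass.coe_one, one_mul, Submonoid.coe_mul]
  rw [h]
  ring

/-- `yz/(yz) = 1`. [folklore] -/
theorem fracYZ_self : fracYZ (K := K) (X 1 * X 2) (mul_mem_two 1 2) = 1 := by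
  refine HomogeneousLocalization.val_injective _ ?_
  rw [HomogeneousLocalization.val_one]
  simp only [HomogeneousLocalization.Away.val_mk, pow_one]
  exact Localization.mk_self ⟨X 1 * X 2, _⟩

/-- In `(K[x]_{yz})₀`: `u · y = x` and `v · y = 1`, i.e.
`(xz/yz)(y²/yz) = xy/yz` and `(z²/yz)(y²/yz) = 1`. [folklore] -/
theorem resY_chartGen_mul_resZ_chartGen :
    resY (ProjectiveSpace.chartGen K 1 0) * resZ (ProjectiveSpace.chartGen K 2 1) =
        resZ (ProjectiveSpace.chartGen K 2 0) ∧
      resY (ProjectiveSpace.chartGen K 1 1) * resZ (ProjectiveSpace.chartGen K 2 1) = 1 := by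
  rw [resY_chartGen, resY_chartGen, resZ_chartGen, resZ_chartGen]
  have h10 : ((1 : Fin 3).succAbove 0) = 0 := by decide
  have h11 : ((1 : Fin 3).succAbove 1) = 2 := by decide
  have h20 : ((2 : Fin 3).succAbove 0) = 0 := by decide
  have h21 : ((2 : Fin 3).succAbove 1) = 1 := by decide
  simp only [h10, h11, h20, h21]
  constructor
  · exact fracYZ_mul_fracYZ _ _ _ (by ring)
  · rw [← fracYZ_self]
    exact fracYZ_mul_fracYZ _ _ _ (by ring)

/-- A `B`-point of the affine chart maps into `D₊(z)`, and one of the chart at infinity into `D₊(y)`. [folklore] -/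
theorem range_comp_chart_curveEmb_subset (i : Fin 3) (hp : Prime (chartPolynomial W i))
    {T : Scheme.{u}} (g : T ⟶ Spec (CommRingCat.of (MvPolynomial (Fin 2) K ⧸ Ideal.span {chartPolynomial W i}))) :
    Set.range (g ≫ chart W i hp ≫ curveEmb W) ⊆ (Proj.basicOpen 𝒜 (X i) : Set (Proj 𝒜)) := by
  rintro _ ⟨t, rfl⟩
  have hmem : chart W i hp (g t) ∈ Set.range (chart W i hp) := ⟨g t, rfl⟩
  rw [range_chart W i hp] at hmem
  exact hmem

/-- **Transition between the charts.** If a `B`-point of `E` lies in both charts, with affine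
coordinates `α` and coordinates at infinity `β`, then `u·y = x` and `v·y = 1` in `B`
(`u = x/y`, `v = 1/y`; Silverman, *AEC*, III.1 and IV.1: `z = −x/y`, `w = −1/y` up to sign). [folklore] -/
theorem transition {B : Type u} [CommRing B] (α : AffineRing W →+* B) (β : InfRing W →+* B)
    (h : Spec.map (CommRingCat.ofHom α) ≫ affineChart W = Spec.map (CommRingCat.ofHom β) ≫ infChart W) :
    β (infU W) * α (affY W) = α (affX W) ∧ β (infV W) * α (affY W) = 1 := by
  set g := Spec.map (CommRingCat.ofHom α) ≫ affineChart W ≫ curveEmb W with hg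
  have hg' : g = Spec.map (CommRingCat.ofHom β) ≫ infChart W ≫ curveEmb W := by
    rw [hg, ← Category.assoc, h, Category.assoc]
  have hrange : Set.range g ⊆ Set.range (awayιYZ (K := K)) := by
    have hr : Set.range (awayιYZ (K := K)) =
        ((Proj.basicOpen 𝒜 (X 1) ⊓ Proj.basicOpen 𝒜 (X 2) : Opens (Proj 𝒜)) : Set (Proj 𝒜)) := by
      rw [← Proj.basicOpen_mul]
      exact congrArg SetLike.coe (Proj.opensRange_awayι 𝒜 _ X_one_mul_X_two_mem two_pos)
    rw [hr, Opens.coe_inf]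
    refine Set.subset_inter ?_ ?_
    · rw [hg']
      exact range_comp_chart_curveEmb_subset W 1 _ _
    · exact range_comp_chart_curveEmb_subset W 2 _ _
  let ρ := IsOpenImmersion.lift awayιYZ g hrange
  have hρ : ρ ≫ awayιYZ = g := IsOpenImmersion.lift_fac _ _ _
  -- comparison over `D₊(z)`
  have EZ : ∀ a, α (chartHom W 2 (ChartIdx.prime W .aff) a) = (Spec.preimage ρ).hom (resZ a) := by
    have key : Spec.map (CommRingCat.ofHom (chartHom W 2 (ChartIdx.prime W .aff)) ≫
        CommRingCat.ofHom α) = Spec.map (CommRingCat.ofHom resZ ≫ Spec.preimage ρ) := by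
      rw [← cancel_mono (Proj.awayι 𝒜 (X 2) (ProjectiveSpace.X_mem 2) one_pos), Spec.map_comp,
        Spec.map_comp, Category.assoc, Category.assoc, specMap_resZ_awayι, Spec.map_preimage, hρ,
        ← chart_curveEmb']
      rfl
    intro a
    have := congrArg (fun φ => φ.hom a) (Spec.map_injective key)
    simpa using this
  -- comparison over `D₊(y)`
  have EY : ∀ a, β (chartHom W 1 (ChartIdx.prime W .inf) a) = (Spec.preimage ρ).hom (resY a) := by
    have key : Spec.map (CommRingCat.ofHom (chartHom W 1 (ChartIdx.prime W .inf)) ≫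
        CommRingCat.ofHom β) = Spec.map (CommRingCat.ofHom resY ≫ Spec.preimage ρ) := by
      rw [← cancel_mono (Proj.awayι 𝒜 (X 1) (ProjectiveSpace.X_mem 1) one_pos), Spec.map_comp,
        Spec.map_comp, Category.assoc, Category.assoc, specMap_resY_awayι, Spec.map_preimage, hρ,
        hg', ← chart_curveEmb']
      rfl
    intro a
    have := congrArg (fun φ => φ.hom a) (Spec.map_injective key)
    simpa using this
  have hx : α (affX W) = (Spec.preimage ρ).hom (resZ (ProjectiveSpace.chartGen K 2 0)) := by
    rw [← EZ, chartHom_chartGen]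
  have hy : α (affY W) = (Spec.preimage ρ).hom (resZ (ProjectiveSpace.chartGen K 2 1)) := by
    rw [← EZ, chartHom_chartGen]
  have hu : β (infU W) = (Spec.preimage ρ).hom (resY (ProjectiveSpace.chartGen K 1 0)) := by
    rw [← EY, chartHom_chartGen]
  have hv : β (infV W) = (Spec.preimage ρ).hom (resY (ProjectiveSpace.chartGen K 1 1)) := by
    rw [← EY, chartHom_chartGen]
  obtain ⟨h1, h2⟩ := resY_chartGen_mul_resZ_chartGen (K := K)
  rw [hx, hy, hu, hv, ← map_mul, ← map_mul, h1, h2, map_one]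
  exact ⟨rfl, rfl⟩

end Charts

end WeierstrassScheme

end Literature.NumberTheory.EllipticCurves
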